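import Summits.QuantumFields.BalabanUV.T4Continuum.Support.SkeletonFillFullNorms

/-!
# T⁴ programme, node NE3 — kinematic refinement lemma, leaf R1c∕R1d (row NE3-S4d), file F4a: THE SECOND-ORDER STRUCTURE OF
# AN INNER PLAQUETTE OF THE CLOSED-FORM FILLING (`W(∂p) = U·h·U⁻¹·[A,B]` EXACTLY) and the IN-CELL COVARIANT FLUX GRADIENT
# (`‖∇_W F‖ ≤ 28θa₀ + 8θ²` — NO term linear in the root radius: «O(∇F∕L² + a²), NOT O(a∕L³)»)

Cell `pub-balaban`, NE3 formalisation swarm, unit `b2b-balaban-t4-ne3-formalise-leaf-07` (LEAF PROVER 07), row **S4d** of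
`t4/formal/NE3/LEAVES.md`; companion of `SkeletonFillFullNorms` (F3a).  SOCKET: the flux-gradient field
`∀ x κ π, ‖covGrad W (flux W) x κ π‖ ≤ c₁∕(L^{j+1})³` of the owner's `ApproxRefine` ∕ row R0's `hR1` for `W := fullFill L T h`
— THIS FILE proves it for the INNER bond∕plaquette pairs (both plaquettes and the transporting bond strictly inside one
block: the bulk of all pairs), with a bound that is SECOND ORDER in the root radius `a₀` (`θ = d(L−1)a₀`); the pairs meeting
a far face (where the covariant root gradient `δ` enters, as in F3a–F3c cases II–IV) are recorded as the open remainder of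
row S4d (LEAVES.md census).

THE MECHANISM.  For an inner plaquette (case I of F2) `W(∂p) = A·B·A′⁻¹·B⁻¹` with `A′ = A·(A₂⁻¹h⁻¹A₂)` (one more row
factor), hence EXACTLY `W(∂p) = U·h·U⁻¹·C`, `U = ABA₂⁻¹`, `C = ABA⁻¹B⁻¹` (a group commutator, `‖C − 1‖ ≤ 2θ²`): every inner
plaquette is a CONJUGATE OF THE SAME ROOT `h(z;μ,ν)` up to a second-order commutator.  Two neighbouring inner plaquettes of
the same plane therefore differ, after the covariant transport by the (near-identity) inner bond, by
`‖Ad_V h − h‖ + (commutators) ≤ 2‖V − 1‖‖h − 1‖ + 4θ² ≤ 14θa₀ + 4θ²`, and the flux gradient (the logarithm being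
`2`-Lipschitz on the ball of radius `1∕2`) by twice that.

CONTENT (all [folklore]; `Matrix n n ℂ`; 0 sorry): §1 `hiProd_step_eq` (`Hμ(z,q+e_ν) = Hμ(z,q)·A₂⁻¹h⁻¹A₂`, group level),
**`hol_plaq_inner_eq_conj_mul_comm`** (the exact structure); §2 `norm_conj_plaq_inner_sub_le` (transported difference of two
inner plaquettes of one plane `≤ 14θa₀ + 4θ²`), **`norm_covGrad_flux_inner_le`** (`≤ 28θa₀ + 8θ²` under `a₀ + 2θ² ≤ 1∕4`).

HONEST FRAMING.  Norm bookkeeping for a kinematic construction; no minimiser, no conditional of the cell (`BetaPertH`, (B),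
(B^μ)); nothing bears on infinite volume, a mass gap, or the Clay problem; **NE3 is NOT proved**; the face pairs of the
gradient field, the mismatch (S4e) and the assembly (R0) remain.  Finite T⁴ rung (B)+1.  ABSOLUTE RULE kept: no printed
sentence is a hypothesis; no `def … : Prop` fact; no `sorry`, axioms ⊆ {propext, Classical.choice, Quot.sound}.  PLACEMENT
(human rule 2026-08-19): under `Summits/QuantumFields/BalabanUV/`; imports F3a only; moves nothing.
-/

set_option autoImplicit false

open scoped BigOperators Matrix Matrix.Norms.L2Operator
open NormedSpace

namespace Summit.QuantumFields.BalabanUV.T4Continuum.SkeletonFillFullGradient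

open Literature.MathematicalPhysics.QuantumFieldTheory.Balaban1983to89
open B7Prop1Explicit B7Prop2Explicit B7Prop1Local MatrixLog UnitaryModel
open T4AveragingDeficitWall hiding Site Plane Plaq Bond
open T4AveragingDeficitNonAbelian (Ad_mul Ad_sub)
open AveragingDeficitTransport AveragingDeficitNearIdentity GaugeFieldPerturbation
open FederbushMean (norm_mlog_sub_mlog_le)
open SkeletonLattice SkeletonFill SkeletonFillFull SkeletonFillFullNorms

noncomputable section

variable {d : ℕ} {n : Type*} [Fintype n] [DecidableEq n]

/-! ## §1 The exact second-order structure of an inner plaquette -/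

section Structure

variable {G : Type*} [Group G]

/-- **ONE MORE ROW FACTOR, AS A GROUP IDENTITY**: for `μ < ν` and `0 ≤ q_ν`, `Hμ(z,q+e_ν) = Hμ(z,q) · (A₂⁻¹ h⁻¹ A₂)` where
`A₂` is the partial row product over the directions listed after `ν` and `h = h(z;μ,ν)`. [folklore] -/
theorem hiProd_step_eq (h : Site d → Fin d → Fin d → G) (z : Site d) {q : Site d} {μ ν : Fin d} (hμν : μ < ν)
    (h0 : 0 ≤ q ν) :
    ∃ A₂ : G, hiProd h z (q + e ν) μ = hiProd h z q μ * (A₂⁻¹ * (h z μ ν)⁻¹ * A₂) ∧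
      ∃ l₂ : List (Fin d), (∀ i ∈ l₂, μ < i) ∧ l₂.length ≤ (above μ).length ∧
        A₂ = prodOver l₂ (fun i => ((h z μ i) ^ (q i).toNat)⁻¹) := by
  obtain ⟨l₁, l₂, hl, hν₁, hν₂, hsplit⟩ := prodOver_split (G := G) (nodup_above μ) (mem_above.mpr hμν)
  set F : Fin d → G := fun i => ((h z μ i) ^ (q i).toNat)⁻¹ with hF
  set F' : Fin d → G := fun i => ((h z μ i) ^ ((q + e ν) i).toNat)⁻¹ with hF'
  have hagree : ∀ i, i ≠ ν → F' i = F i := fun i hi => by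
    simp only [hF, hF', Pi.add_apply, e_apply, if_neg hi, add_zero]
  have h1 : prodOver l₁ F' = prodOver l₁ F := prodOver_congr fun i hi => hagree i (fun he => hν₁ (he ▸ hi))
  have h2 : prodOver l₂ F' = prodOver l₂ F := prodOver_congr fun i hi => hagree i (fun he => hν₂ (he ▸ hi))
  refine ⟨prodOver l₂ F, ?_, l₂, fun i hi => ?_, ?_, rfl⟩
  · rw [show hiProd h z (q + e ν) μ = prodOver (above μ) F' from rfl, hsplit F', h1, h2,
      show hiProd h z q μ = prodOver (above μ) F from rfl, hsplit F]
    simp only [hF, hF', toNat_add_e_self h0, pow_succ, mul_inv_rev]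
    group
  · have : i ∈ above μ := by rw [hl]; exact List.mem_append_right _ (List.mem_cons_of_mem _ hi)
    exact mem_above.mp this
  · have := congrArg List.length hl; simp only [List.length_append, List.length_cons] at this; omega

/-- **THE EXACT STRUCTURE OF AN INNER PLAQUETTE**: `W(∂p) = U·h·U⁻¹·C` with `U = A·B·A₂⁻¹` and the commutator
`C = A·B·A⁻¹·B⁻¹` of the two row products (`A = Hμ(z,q)`, `B = Hν(z,q)`). [folklore] -/
theorem hol_plaq_inner_eq_conj_mul_comm {L : ℕ} (T : Site d → Fin d → G) (h : Site d → Fin d → Fin d → G)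
    {z q : Site d} (hq : InBox L q) {μ ν : Fin d} (hμν : μ < ν) (hμ : q μ < (L : ℤ) - 1) (hν : q ν < (L : ℤ) - 1) :
    ∃ A₂ : G, (∃ l₂ : List (Fin d), (∀ i ∈ l₂, μ < i) ∧ l₂.length ≤ (above μ).length ∧
        A₂ = prodOver l₂ (fun i => ((h z μ i) ^ (q i).toNat)⁻¹)) ∧
      hol (fullFill L T h) ((L : ℤ) • z + q) (plaqWord μ ν)
        = (hiProd h z q μ * hiProd h z q ν * A₂⁻¹) * h z μ ν * (hiProd h z q μ * hiProd h z q ν * A₂⁻¹)⁻¹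
          * (hiProd h z q μ * hiProd h z q ν * (hiProd h z q μ)⁻¹ * (hiProd h z q ν)⁻¹) := by
  obtain ⟨A₂, hstep, l₂, hl₂, hlen, hA₂⟩ := hiProd_step_eq h z hμν (hq ν).1
  refine ⟨A₂, ⟨l₂, hl₂, hlen, hA₂⟩, ?_⟩
  rw [hol_plaq_fullFill_inner hq hμν hμ hν, hstep]
  group

end Structure

/-! ## §2 The in-cell covariant flux gradient is second order -/

section Gradient

variable [Nonempty n] {L : ℕ} {a₀ : ℝ}

/-- **TRANSPORTED DIFFERENCE OF TWO INNER PLAQUETTES OF ONE PLANE**: for inner plaquettes at `q` and `q′` of the block `z`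
(plane `μ < ν`) and a unitary transporter `w` within `θ` of `1`, `‖w·W(∂p′)·w⁻¹ − W(∂p)‖ ≤ 14θa₀ + 4θ²`
(`θ = d(L−1)a₀`): both are conjugates of the same root up to commutators. [folklore] -/
theorem norm_conj_plaq_inner_sub_le {T : Site d → Fin d → (Matrix n n ℂ)ˣ} {h : Site d → Fin d → Fin d → (Matrix n n ℂ)ˣ}
    (hh : ∀ (z : Site d) (κ ν : Fin d), h z κ ν ∈ unitaryUnits (Matrix n n ℂ))
    (ha : ∀ (z : Site d) (κ ν : Fin d), κ < ν → ‖((h z κ ν : (Matrix n n ℂ)ˣ) : Matrix n n ℂ) - 1‖ ≤ a₀) (ha0 : 0 ≤ a₀)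
    {z q q' : Site d} (hq : InBox L q) (hq' : InBox L q') {μ ν : Fin d} (hμν : μ < ν)
    (hμ : q μ < (L : ℤ) - 1) (hν : q ν < (L : ℤ) - 1) (hμ' : q' μ < (L : ℤ) - 1) (hν' : q' ν < (L : ℤ) - 1)
    {w : (Matrix n n ℂ)ˣ} (hw : w ∈ unitaryUnits (Matrix n n ℂ))
    (hwθ : ‖(w : Matrix n n ℂ) - 1‖ ≤ d * ((L - 1 : ℕ) * a₀)) :
    ‖((w * hol (fullFill L T h) ((L : ℤ) • z + q') (plaqWord μ ν) * w⁻¹ : (Matrix n n ℂ)ˣ) : Matrix n n ℂ)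
        - ((hol (fullFill L T h) ((L : ℤ) • z + q) (plaqWord μ ν) : (Matrix n n ℂ)ˣ) : Matrix n n ℂ)‖
      ≤ 14 * (d * ((L - 1 : ℕ) * a₀)) * a₀ + 4 * (d * ((L - 1 : ℕ) * a₀)) * (d * ((L - 1 : ℕ) * a₀)) := by
  set θ : ℝ := d * ((L - 1 : ℕ) * a₀) with hθdef
  have hθ0 : 0 ≤ θ := by positivity
  set g := h z μ ν with hgdef
  have hgu : g ∈ unitaryUnits (Matrix n n ℂ) := hh _ _ _
  have hF : ∀ (q'' : Site d) (i : Fin d), ((h z μ i) ^ (q'' i).toNat)⁻¹ ∈ unitaryUnits (Matrix n n ℂ) := fun _ _ =>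
    (unitaryUnits _).inv_mem ((unitaryUnits _).pow_mem (hh _ _ _) _)
  have huA : ∀ (q'' : Site d) (κ : Fin d), hiProd h z q'' κ ∈ unitaryUnits (Matrix n n ℂ) := fun _ _ =>
    prodOver_mem fun i _ => (unitaryUnits _).inv_mem ((unitaryUnits _).pow_mem (hh _ _ _) _)
  -- structure of both plaquettes
  obtain ⟨A₂, ⟨l₂, hl₂, hlen, hA₂⟩, hP⟩ := hol_plaq_inner_eq_conj_mul_comm (G := (Matrix n n ℂ)ˣ) T h hq hμν hμ hν
  obtain ⟨A₂', ⟨l₂', hl₂', hlen', hA₂'⟩, hP'⟩ :=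
    hol_plaq_inner_eq_conj_mul_comm (G := (Matrix n n ℂ)ˣ) T h hq' hμν hμ' hν'
  set A := hiProd h z q μ; set B := hiProd h z q ν; set A' := hiProd h z q' μ; set B' := hiProd h z q' ν
  set U : (Matrix n n ℂ)ˣ := A * B * A₂⁻¹ with hUdef
  set C : (Matrix n n ℂ)ˣ := A * B * A⁻¹ * B⁻¹ with hCdef
  set U' : (Matrix n n ℂ)ˣ := A' * B' * A₂'⁻¹ with hU'def
  set C' : (Matrix n n ℂ)ˣ := A' * B' * A'⁻¹ * B'⁻¹ with hC'def
  have huA₂ : A₂ ∈ unitaryUnits (Matrix n n ℂ) := by rw [hA₂]; exact prodOver_mem fun i _ => hF _ _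
  have huA₂' : A₂' ∈ unitaryUnits (Matrix n n ℂ) := by rw [hA₂']; exact prodOver_mem fun i _ => hF _ _
  have huU : U ∈ unitaryUnits (Matrix n n ℂ) :=
    (unitaryUnits _).mul_mem ((unitaryUnits _).mul_mem (huA _ _) (huA _ _)) ((unitaryUnits _).inv_mem huA₂)
  have huU' : U' ∈ unitaryUnits (Matrix n n ℂ) :=
    (unitaryUnits _).mul_mem ((unitaryUnits _).mul_mem (huA _ _) (huA _ _)) ((unitaryUnits _).inv_mem huA₂')
  have huC : C ∈ unitaryUnits (Matrix n n ℂ) := (unitaryUnits _).mul_mem ((unitaryUnits _).mul_mem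
    ((unitaryUnits _).mul_mem (huA _ _) (huA _ _)) ((unitaryUnits _).inv_mem (huA _ _))) ((unitaryUnits _).inv_mem (huA _ _))
  have huC' : C' ∈ unitaryUnits (Matrix n n ℂ) := (unitaryUnits _).mul_mem ((unitaryUnits _).mul_mem
    ((unitaryUnits _).mul_mem (huA _ _) (huA _ _)) ((unitaryUnits _).inv_mem (huA _ _))) ((unitaryUnits _).inv_mem (huA _ _))
  -- sizes: row products `≤ θ`, partial products `≤ θ`, commutators `≤ 2θ²`
  have hθA : ∀ (q'' : Site d), InBox L q'' → ∀ κ, ‖((hiProd h z q'' κ : (Matrix n n ℂ)ˣ) : Matrix n n ℂ) - 1‖ ≤ θ :=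
    fun q'' hq'' κ => norm_hiProd_sub_one_le hh ha ha0 z hq'' κ
  have hpartial : ∀ {q'' : Site d} (_ : InBox L q'') {l : List (Fin d)} (_ : ∀ i ∈ l, μ < i)
      (_ : l.length ≤ (above μ).length),
      ‖((prodOver l (fun i => ((h z μ i) ^ (q'' i).toNat)⁻¹) : (Matrix n n ℂ)ˣ) : Matrix n n ℂ) - 1‖ ≤ θ := by
    intro q'' hq'' l hl hll
    have hlen2 : (l.length : ℝ) ≤ d := by
      have h1 := List.length_filter_le (fun ν => decide (μ < ν)) (List.finRange d)
      rw [List.length_finRange] at h1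
      exact_mod_cast hll.trans h1
    refine (norm_val_prodOver_sub_one_le (fun i _ => hF _ _) (c := (L - 1 : ℕ) * a₀) fun i hi => ?_).trans
      (by rw [hθdef]; exact mul_le_mul_of_nonneg_right hlen2 (by positivity))
    rw [norm_val_inv_sub_one ((unitaryUnits _).pow_mem (hh _ _ _) _)]
    refine (norm_val_pow_sub_one_le (hh _ _ _) _).trans ?_
    exact mul_le_mul (by exact_mod_cast toNat_le_of_inBox hq'' i) (ha _ _ _ (hl i hi)) (norm_nonneg _) (by positivity)
  have hθA₂ : ‖(A₂ : Matrix n n ℂ) - 1‖ ≤ θ := by rw [hA₂]; exact hpartial hq hl₂ hlen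
  have hθA₂' : ‖(A₂' : Matrix n n ℂ) - 1‖ ≤ θ := by rw [hA₂']; exact hpartial hq' hl₂' hlen'
  have hθU : ‖(U : Matrix n n ℂ) - 1‖ ≤ 3 * θ := by
    rw [hUdef, Units.val_mul, Units.val_mul]
    refine (B8Ineq170.norm_mul_sub_one_le_of_norm_le_one
      (norm_val_of_unitary ((unitaryUnits _).mul_mem (huA _ _) (huA _ _))).le).trans ?_
    rw [norm_val_inv_sub_one huA₂]
    refine (add_le_add (B8Ineq170.norm_mul_sub_one_le_of_norm_le_one (norm_val_of_unitary (huA _ _)).le) hθA₂).trans ?_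
    linarith [hθA q hq μ, hθA q hq ν]
  have hθU' : ‖(U' : Matrix n n ℂ) - 1‖ ≤ 3 * θ := by
    rw [hU'def, Units.val_mul, Units.val_mul]
    refine (B8Ineq170.norm_mul_sub_one_le_of_norm_le_one
      (norm_val_of_unitary ((unitaryUnits _).mul_mem (huA _ _) (huA _ _))).le).trans ?_
    rw [norm_val_inv_sub_one huA₂']
    refine (add_le_add (B8Ineq170.norm_mul_sub_one_le_of_norm_le_one (norm_val_of_unitary (huA _ _)).le) hθA₂').trans ?_
    linarith [hθA q' hq' μ, hθA q' hq' ν]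
  have hθC : ‖(C : Matrix n n ℂ) - 1‖ ≤ 2 * θ * θ := by
    rw [hCdef, norm_val_plaq4_sub_one (huA _ _) (huA _ _), Units.val_mul, Units.val_mul]
    refine (norm_comm_le _ _).trans ?_
    have := mul_le_mul (hθA q hq μ) (hθA q hq ν) (norm_nonneg _) hθ0
    nlinarith [this, norm_nonneg (((hiProd h z q μ : (Matrix n n ℂ)ˣ) : Matrix n n ℂ) - 1),
      norm_nonneg (((hiProd h z q ν : (Matrix n n ℂ)ˣ) : Matrix n n ℂ) - 1)]
  have hθC' : ‖(C' : Matrix n n ℂ) - 1‖ ≤ 2 * θ * θ := by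
    rw [hC'def, norm_val_plaq4_sub_one (huA _ _) (huA _ _), Units.val_mul, Units.val_mul]
    refine (norm_comm_le _ _).trans ?_
    have := mul_le_mul (hθA q' hq' μ) (hθA q' hq' ν) (norm_nonneg _) hθ0
    nlinarith [this, norm_nonneg (((hiProd h z q' μ : (Matrix n n ℂ)ˣ) : Matrix n n ℂ) - 1),
      norm_nonneg (((hiProd h z q' ν : (Matrix n n ℂ)ˣ) : Matrix n n ℂ) - 1)]
  -- the chain: `w P' w⁻¹ = (wU') g (wU')⁻¹ (w C' w⁻¹)` vs `P = U g U⁻¹ C`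
  rw [hP, hP']
  have eL : (w * (U' * g * U'⁻¹ * C') * w⁻¹ : (Matrix n n ℂ)ˣ) = (w * U') * g * (w * U')⁻¹ * (w * C' * w⁻¹) := by group
  rw [show (A' * B' * A₂'⁻¹ * g * (A' * B' * A₂'⁻¹)⁻¹ * (A' * B' * A'⁻¹ * B'⁻¹) : (Matrix n n ℂ)ˣ) = U' * g * U'⁻¹ * C'
      by rw [hU'def, hC'def], show (A * B * A₂⁻¹ * g * (A * B * A₂⁻¹)⁻¹ * (A * B * A⁻¹ * B⁻¹) : (Matrix n n ℂ)ˣ)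
      = U * g * U⁻¹ * C by rw [hUdef, hCdef], eL]
  have huwU' : w * U' ∈ unitaryUnits (Matrix n n ℂ) := (unitaryUnits _).mul_mem hw huU'
  have huwC' : w * C' * w⁻¹ ∈ unitaryUnits (Matrix n n ℂ) :=
    (unitaryUnits _).mul_mem ((unitaryUnits _).mul_mem hw huC') ((unitaryUnits _).inv_mem hw)
  -- step 1: drop the commutators
  have s1 : ‖(((w * U') * g * (w * U')⁻¹ * (w * C' * w⁻¹) : (Matrix n n ℂ)ˣ) : Matrix n n ℂ)
      - (((w * U') * g * (w * U')⁻¹ : (Matrix n n ℂ)ˣ) : Matrix n n ℂ)‖ ≤ 2 * θ * θ := by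
    rw [show ((w * U') * g * (w * U')⁻¹ : (Matrix n n ℂ)ˣ) = (w * U') * g * (w * U')⁻¹ * 1 by rw [mul_one],
      show ((w * U') * g * (w * U')⁻¹ * 1 * (w * C' * w⁻¹) : (Matrix n n ℂ)ˣ) = (w * U') * g * (w * U')⁻¹ * (w * C' * w⁻¹)
        by rw [mul_one], norm_val_mul_left_sub ((unitaryUnits _).mul_mem ((unitaryUnits _).mul_mem huwU' hgu)
        ((unitaryUnits _).inv_mem huwU')), Units.val_one]
    have e1 : ((w * C' * w⁻¹ : (Matrix n n ℂ)ˣ) : Matrix n n ℂ) - 1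
        = ((w * C' * w⁻¹ : (Matrix n n ℂ)ˣ) : Matrix n n ℂ) - ((w * 1 * w⁻¹ : (Matrix n n ℂ)ˣ) : Matrix n n ℂ) := by
      rw [mul_one, mul_inv_cancel, Units.val_one]
    rw [e1, norm_val_frame_sub hw ((unitaryUnits _).inv_mem hw), Units.val_one]
    exact hθC'
  have s3 : ‖((U * g * U⁻¹ : (Matrix n n ℂ)ˣ) : Matrix n n ℂ) - ((U * g * U⁻¹ * C : (Matrix n n ℂ)ˣ) : Matrix n n ℂ)‖
      ≤ 2 * θ * θ := by
    rw [show (U * g * U⁻¹ : (Matrix n n ℂ)ˣ) = U * g * U⁻¹ * 1 by rw [mul_one],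
      show (U * g * U⁻¹ * 1 * C : (Matrix n n ℂ)ˣ) = U * g * U⁻¹ * C by rw [mul_one],
      norm_val_mul_left_sub ((unitaryUnits _).mul_mem ((unitaryUnits _).mul_mem huU hgu) ((unitaryUnits _).inv_mem huU)),
      Units.val_one, norm_sub_rev]
    exact hθC
  -- step 2: two conjugates of the same root
  have s2 : ‖(((w * U') * g * (w * U')⁻¹ : (Matrix n n ℂ)ˣ) : Matrix n n ℂ) - ((U * g * U⁻¹ : (Matrix n n ℂ)ˣ) : Matrix n n ℂ)‖
      ≤ 2 * (7 * θ) * a₀ := by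
    -- `Ad_{wU'} g − Ad_U g = Ad_U (Ad_{U⁻¹wU'} g − g)`
    set V : (Matrix n n ℂ)ˣ := U⁻¹ * (w * U') with hVdef
    have huV : V ∈ unitaryUnits (Matrix n n ℂ) := (unitaryUnits _).mul_mem ((unitaryUnits _).inv_mem huU) huwU'
    rw [show ((w * U') * g * (w * U')⁻¹ : (Matrix n n ℂ)ˣ) = U * (V * g * V⁻¹) * U⁻¹ by rw [hVdef]; group,
      norm_val_frame_sub huU ((unitaryUnits _).inv_mem huU)]
    refine (norm_val_conj_sub_le huV g).trans ?_
    have hV1 : ‖(V : Matrix n n ℂ) - 1‖ ≤ 7 * θ := by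
      rw [hVdef, Units.val_mul]
      refine (B8Ineq170.norm_mul_sub_one_le_of_norm_le_one
        (norm_val_of_unitary ((unitaryUnits _).inv_mem huU)).le).trans ?_
      rw [norm_val_inv_sub_one huU, Units.val_mul]
      refine (add_le_add hθU ((B8Ineq170.norm_mul_sub_one_le_of_norm_le_one (norm_val_of_unitary hw).le).trans
        (add_le_add hwθ hθU'))).trans ?_
      linarith
    have := mul_le_mul hV1 (ha z μ ν hμν) (norm_nonneg _) (by positivity)
    nlinarith [this, norm_nonneg ((V : Matrix n n ℂ) - 1), norm_nonneg (((g : (Matrix n n ℂ)ˣ) : Matrix n n ℂ) - 1)]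
  calc _ ≤ ‖(((w * U') * g * (w * U')⁻¹ * (w * C' * w⁻¹) : (Matrix n n ℂ)ˣ) : Matrix n n ℂ)
          - (((w * U') * g * (w * U')⁻¹ : (Matrix n n ℂ)ˣ) : Matrix n n ℂ)‖
        + ‖(((w * U') * g * (w * U')⁻¹ : (Matrix n n ℂ)ˣ) : Matrix n n ℂ) - ((U * g * U⁻¹ * C : (Matrix n n ℂ)ˣ) : Matrix n n ℂ)‖ :=
        norm_sub_le_norm_sub_add_norm_sub _ _ _
    _ ≤ 2 * θ * θ + (2 * (7 * θ) * a₀ + 2 * θ * θ) :=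
        add_le_add s1 ((norm_sub_le_norm_sub_add_norm_sub _ _ _).trans (add_le_add s2 s3))
    _ = _ := by rw [hθdef]; ring

/-- **THE IN-CELL COVARIANT FLUX GRADIENT IS SECOND ORDER**: for an inner transporting bond `(x, ρ)` (`q_ρ < L − 1`) between
two inner plaquettes of the plane `μ < ν` of the same block, `‖(∇_W F)(x, ρ; μν)‖ ≤ 28θa₀ + 8θ²` provided `a₀ + 2θ² ≤ 1∕4`
(so that both plaquettes lie in the ball where `log` is `2`-Lipschitz).  NO term linear in `a₀`: the rows are even.
[folklore] -/
theorem norm_covGrad_flux_inner_le {T : Site d → Fin d → (Matrix n n ℂ)ˣ} {h : Site d → Fin d → Fin d → (Matrix n n ℂ)ˣ}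
    (hh : ∀ (z : Site d) (κ ν : Fin d), h z κ ν ∈ unitaryUnits (Matrix n n ℂ))
    (ha : ∀ (z : Site d) (κ ν : Fin d), κ < ν → ‖((h z κ ν : (Matrix n n ℂ)ˣ) : Matrix n n ℂ) - 1‖ ≤ a₀) (ha0 : 0 ≤ a₀)
    (hsmall : a₀ + 2 * (d * ((L - 1 : ℕ) * a₀)) * (d * ((L - 1 : ℕ) * a₀)) ≤ 1 / 4)
    {z q : Site d} (hq : InBox L q) {μ ν ρ : Fin d} (hμν : μ < ν)
    (hμ : q μ < (L : ℤ) - 1) (hν : q ν < (L : ℤ) - 1) (hρ : q ρ < (L : ℤ) - 1)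
    (hμ' : (q + e ρ) μ < (L : ℤ) - 1) (hν' : (q + e ρ) ν < (L : ℤ) - 1) :
    ‖covGrad (fullFill L T h) (flux (fullFill L T h)) ((L : ℤ) • z + q) ρ ⟨(μ, ν), hμν⟩‖
      ≤ 28 * (d * ((L - 1 : ℕ) * a₀)) * a₀ + 8 * (d * ((L - 1 : ℕ) * a₀)) * (d * ((L - 1 : ℕ) * a₀)) := by
  set θ : ℝ := d * ((L - 1 : ℕ) * a₀) with hθdef
  have hθ0 : 0 ≤ θ := by positivity
  have hq' : InBox L (q + e ρ) := inBox_add_e hq hρ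
  set P : (Matrix n n ℂ)ˣ := hol (fullFill L T h) ((L : ℤ) • z + q) (plaqWord μ ν) with hPdef
  set P' : (Matrix n n ℂ)ˣ := hol (fullFill L T h) ((L : ℤ) • z + q + e ρ) (plaqWord μ ν) with hP'def
  set w : (Matrix n n ℂ)ˣ := fullFill L T h ((L : ℤ) • z + q) ρ with hwdef
  have hwval : w = hiProd h z q ρ := by rw [hwdef, fullFill_repr hq, fullVal_of_ne (ne_of_lt hρ)]
  have hwu : w ∈ unitaryUnits (Matrix n n ℂ) := by
    rw [hwval]; exact prodOver_mem fun i _ => (unitaryUnits _).inv_mem ((unitaryUnits _).pow_mem (hh _ _ _) _)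
  have hwθ : ‖(w : Matrix n n ℂ) - 1‖ ≤ θ := by rw [hwval]; exact norm_hiProd_sub_one_le hh ha ha0 z hq ρ
  -- both plaquettes are within `a₀ + 2θ² ≤ 1/4` of `1`
  have hP1 : ‖(P : Matrix n n ℂ) - 1‖ ≤ 1 / 4 :=
    (norm_plaq_inner_sub_one_le (T := T) hh ha ha0 hq hμν hμ hν).trans hsmall
  have hP'1 : ‖((w * P' * w⁻¹ : (Matrix n n ℂ)ˣ) : Matrix n n ℂ) - 1‖ ≤ 1 / 4 := by
    have e1 : ((w * P' * w⁻¹ : (Matrix n n ℂ)ˣ) : Matrix n n ℂ) - 1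
        = ((w * P' * w⁻¹ : (Matrix n n ℂ)ˣ) : Matrix n n ℂ) - ((w * 1 * w⁻¹ : (Matrix n n ℂ)ˣ) : Matrix n n ℂ) := by
      rw [mul_one, mul_inv_cancel, Units.val_one]
    rw [e1, norm_val_frame_sub hwu ((unitaryUnits _).inv_mem hwu), Units.val_one, hP'def, add_assoc]
    exact (norm_plaq_inner_sub_one_le (T := T) hh ha ha0 hq' hμν hμ' hν').trans hsmall
  -- the covariant gradient is a difference of logarithms of the transported plaquette and the plaquette
  have hcov : covGrad (fullFill L T h) (flux (fullFill L T h)) ((L : ℤ) • z + q) ρ ⟨(μ, ν), hμν⟩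
      = mlog ((w * P' * w⁻¹ : (Matrix n n ℂ)ˣ) : Matrix n n ℂ) - mlog (P : Matrix n n ℂ) := by
    unfold covGrad flux fhol
    simp only
    rw [← hP'def, ← hPdef, ← hwdef, Ad, Units.val_mul, Units.val_mul,
      ← mlog_units_conj (mem_U1_of_unitary hwu)]
    have hP'u : ‖(P' : Matrix n n ℂ) - 1‖ < 1 := by
      have := hP'1
      rw [show ((w * P' * w⁻¹ : (Matrix n n ℂ)ˣ) : Matrix n n ℂ) - 1
        = ((w * P' * w⁻¹ : (Matrix n n ℂ)ˣ) : Matrix n n ℂ) - ((w * 1 * w⁻¹ : (Matrix n n ℂ)ˣ) : Matrix n n ℂ) by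
          rw [mul_one, mul_inv_cancel, Units.val_one], norm_val_frame_sub hwu ((unitaryUnits _).inv_mem hwu),
        Units.val_one] at this
      linarith
    exact hP'u
  have hkey : ‖mlog ((w * P' * w⁻¹ : (Matrix n n ℂ)ˣ) : Matrix n n ℂ) - mlog (P : Matrix n n ℂ)‖
      ≤ 2 * ‖((w * P' * w⁻¹ : (Matrix n n ℂ)ˣ) : Matrix n n ℂ) - (P : Matrix n n ℂ)‖ := by
    have h2 := norm_mlog_sub_mlog_le (ρ := 1 / 2) (by norm_num) (hP'1.trans (by norm_num)) (hP1.trans (by norm_num))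
    have hc : (1 + 1 / 2 / (1 - 1 / 2) : ℝ) = 2 := by norm_num
    rw [hc] at h2
    exact h2
  have e3 : (L : ℤ) • z + q + e ρ = (L : ℤ) • z + (q + e ρ) := add_assoc _ _ _
  have hdiff : ‖((w * P' * w⁻¹ : (Matrix n n ℂ)ˣ) : Matrix n n ℂ) - (P : Matrix n n ℂ)‖ ≤ 14 * θ * a₀ + 4 * θ * θ := by
    rw [hP'def, hPdef, e3]
    exact norm_conj_plaq_inner_sub_le (z := z) (T := T) hh ha ha0 hq hq' hμν hμ hν hμ' hν' hwu hwθ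
  rw [hcov]
  linarith [hkey, hdiff]

end Gradient

end

end Summit.QuantumFields.BalabanUV.T4Continuum.SkeletonFillFullGradient
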